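import Summits.AtomisticToContinuum.HydrodynamicLimit.Theses.OneFlightGossipEngine
import Summits.AtomisticToContinuum.HydrodynamicLimit.Theorems.BandCoherenceLDAlongFamilies.Negative.Pathwise
import Summits.AtomisticToContinuum.HydrodynamicLimit.Theorems.BandCoherenceLDAlongFamilies.Negative.Gauss
import Summits.AtomisticToContinuum.HydrodynamicLimit.Theorems.JParityClosureRateFloorDriftEntropy
import Summits.AtomisticToContinuum.HydrodynamicLimit.Theorems.JParityClosureOddContactSymmetryGibbsInvariance
import Summits.AtomisticToContinuum.HydrodynamicLimit.Theorems.CollisionIsometryCLTMacroClosureStubClausiusDV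
import Summits.AtomisticToContinuum.HydrodynamicLimit.Theorems.AntiMazurCoboundariesPressureCertificateTransfer
import Literature.Analysis.FluidPDE.HardSphereFlowJointMeasurable
import Literature.Analysis.FluidPDE.HardSphereAlexander
import Literature.MathematicalPhysics.KineticTheory.HardSphereUniformGas
import HarnessLib

/-!
# Refutation of `OneFlightGossipEngine.BandCoherenceLDAlongFamilies` (stmt-AtomisticToContinuum-17700)

Skeleton (work file).
-/

noncomputable section

open MeasureTheory ProbabilityTheory Set Filter Topology InformationTheory
open scoped ENNReal InnerProductSpace BigOperators

namespace Summit.AtomisticToContinuum.HydrodynamicLimit.Theorems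

namespace BandCoherenceLDRefutation

open Literature.MathematicalPhysics.KineticTheory Literature.Analysis.FluidPDE
open BandCoherenceLDNegative

/-! ## §1 Entropy inequality for a.e.-measurable nonnegative observables -/

/-- Gibbs / Donsker–Varadhan inequality for an a.e.-measurable, a.e.-nonnegative, possibly unbounded observable:
for probability measures `μ, ν` with `KL(μ‖ν) < ∞` and `∫⁻ e^F dν ≤ e^B`, `F` is `μ`-integrable and `∫ F dμ ≤ KL(μ‖ν) + B`.
[cite: KipnisLandim1999, Appendix 1 Thm. 8.3 (p. 338), lower-bound half] -/
theorem integral_le_toReal_klDiv_add_of_nonneg_ae {α : Type*} [MeasurableSpace α] {μ ν : Measure α}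
    [IsProbabilityMeasure μ] [IsProbabilityMeasure ν] (hfin : klDiv μ ν ≠ ⊤) {F : α → ℝ}
    (hF : AEMeasurable F ν) (hF0 : 0 ≤ᵐ[ν] F) {B : ℝ}
    (hB : ∫⁻ x, ENNReal.ofReal (Real.exp (F x)) ∂ν ≤ ENNReal.ofReal (Real.exp B)) :
    Integrable F μ ∧ ∫ x, F x ∂μ ≤ (klDiv μ ν).toReal + B := by
  have hac : μ ≪ ν := (klDiv_ne_top_iff.1 hfin).1
  set F' : α → ℝ := fun x => max (hF.mk F x) 0 with hF'
  have hF'm : Measurable F' := hF.measurable_mk.max measurable_const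
  have hF'0 : ∀ x, 0 ≤ F' x := fun x => le_max_right _ _
  have hae : F =ᵐ[ν] F' := by
    filter_upwards [hF.ae_eq_mk, hF0] with x hx h0
    simp only [hF']
    rw [← hx]
    exact (max_eq_left (by simpa using h0)).symm
  have haeμ : F =ᵐ[μ] F' := hac.ae_le hae
  have hB' : ∫⁻ x, ENNReal.ofReal (Real.exp (F' x)) ∂ν ≤ ENNReal.ofReal (Real.exp B) := by
    have h : (fun x => ENNReal.ofReal (Real.exp (F' x))) =ᵐ[ν] fun x => ENNReal.ofReal (Real.exp (F x)) :=
      hae.mono fun x hx => by simp only [hx]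
    rw [lintegral_congr_ae h]
    exact hB
  obtain ⟨hint, hle⟩ :=
    MacroClosureLine.Barycentric.Clausius.integral_le_toReal_klDiv_add_of_nonneg hfin hF'm hF'0 hB'
  refine ⟨hint.congr haeμ.symm, ?_⟩
  rw [integral_congr_ae haeμ]
  exact hle

/-! ## §2 Window means under a flow-invariant law (registered helper stubs) -/

/-- W1 · **Fubini + invariance for bounded observables.** For a finite law `μ` preserved by every `Φ_t` and carried by
the good set, and a bounded measurable `f`, the window integral `z ↦ ∫_a^b f(Φ_s z) ds` is `μ`-integrable with mean
`(b − a) ∫ f dμ`. [folklore] -/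
theorem stub_integral_intervalIntegral_comp_flow {N : ℕ} {ε : ℝ}
    (Φ : HardSphereFlow (Torus.geometry (Fin 3)) ε N)
    (μ : Measure (Config N (Fin 3) T3)) [IsFiniteMeasure μ] (hinv : ∀ t, MeasurePreserving (Φ.flow t) μ μ)
    (hgood : μ Φ.goodᶜ = 0) {f : Config N (Fin 3) T3 → ℝ} (hf : Measurable f) {C : ℝ} (hC : ∀ z, |f z| ≤ C)
    {a b : ℝ} (hab : a ≤ b) :
    Integrable (fun z => ∫ s in a..b, f (Φ.flow s z)) μ ∧
      ∫ z, (∫ s in a..b, f (Φ.flow s z)) ∂μ = (b - a) * ∫ z, f z ∂μ := by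
  sorry

/-- W2 · **Tonelli + invariance for nonnegative integrable observables.** Same setting, `f ≥ 0` measurable and
`μ`-integrable: the window integral is `μ`-integrable with mean `≤ (b − a) ∫ f dμ`. [folklore] -/
theorem stub_integral_intervalIntegral_comp_flow_of_nonneg {N : ℕ} {ε : ℝ}
    (Φ : HardSphereFlow (Torus.geometry (Fin 3)) ε N)
    (μ : Measure (Config N (Fin 3) T3)) [IsFiniteMeasure μ] (hinv : ∀ t, MeasurePreserving (Φ.flow t) μ μ)
    (hgood : μ Φ.goodᶜ = 0) {f : Config N (Fin 3) T3 → ℝ} (hf : Measurable f) (hf0 : ∀ z, 0 ≤ f z)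
    (hfi : Integrable f μ) {a b : ℝ} (hab : a ≤ b) :
    Integrable (fun z => ∫ s in a..b, f (Φ.flow s z)) μ ∧
      ∫ z, (∫ s in a..b, f (Φ.flow s z)) ∂μ ≤ (b - a) * ∫ z, f z ∂μ := by
  sorry

/-- W3 · **One-body velocity marginal of the homogeneous local Gibbs law**: for constant profiles `a, θ > 0`, `u` and
`σ ≤ 1/2`, the law of the velocity of particle `i` under `G_N(a, u, θ)` is `N(u, θ id)`. [folklore] -/
theorem stub_map_vel_localGibbsLaw_const {σ a θ : ℝ} (hσ2 : σ ≤ 1 / 2) (ha : 0 < a) (hθ : 0 < θ) (u : V3) (N : ℕ)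
    (Φ : HardSphereFlow (Torus.geometry (Fin 3)) (hsDiameter σ N) (N + 1)) (i : Fin (N + 1)) :
    (localGibbsLaw σ (fun _ => a) (fun _ => u) (fun _ => θ) N Φ).map (fun z => (z i).2) = gaussMeasure u θ := by
  sorry

/-- W4 · **Vector-valued window integrals along the flow are a.e.-strongly measurable** for every law carried by the good
set. [folklore] -/
theorem stub_aestronglyMeasurable_intervalIntegral_comp_flow_vec {N : ℕ} {ε : ℝ}
    (Φ : HardSphereFlow (Torus.geometry (Fin 3)) ε N) {F : Config N (Fin 3) T3 → V3} (hF : Measurable F)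
    (a b : ℝ) {μ : Measure (Config N (Fin 3) T3)} (hμ : μ Φ.goodᶜ = 0) :
    AEStronglyMeasurable (fun z => ∫ s in a..b, F (Φ.flow s z)) μ := by
  sorry

/-- W5 · **The band-coherence functional is a.e.-measurable** under every law carried by the good set. [folklore] -/
theorem stub_aemeasurable_bandFunctional {N : ℕ} {ε : ℝ} (Φ : HardSphereFlow (Torus.geometry (Fin 3)) ε N)
    {μ : Measure (Config N (Fin 3) T3)} (hμ : μ Φ.goodᶜ = 0) (w k K η : ℝ) (c : V3) :
    AEMeasurable (fun z => ∑ i : Fin N,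
        (if η * (w⁻¹ * ∫ r in (0:ℝ)..w, ‖(Φ.flow r z i).2 - c‖ ^ 3) <
            ‖w⁻¹ • ∫ r in (0:ℝ)..w, (if k ^ 2 < ‖(Φ.flow r z i).2 - c‖ ^ 2 ∧ ‖(Φ.flow r z i).2 - c‖ ^ 2 ≤ K ^ 2
                then ‖(Φ.flow r z i).2 - c‖ ^ 2 - k ^ 2 else 0) • ((Φ.flow r z i).2 - c)‖
          then w⁻¹ * ∫ r in (0:ℝ)..w,
            (if k < ‖(Φ.flow r z i).2 - c‖ ∧ ‖(Φ.flow r z i).2 - c‖ ≤ K then ‖(Φ.flow r z i).2 - c‖ ^ 3 else 0)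
          else 0)) μ := by
  sorry

/-! ## §3 The drift entropy bound (★) -/

/-- (★) **Entropy bound for the band-coherence functional under a drifted reference.** If the exponential moment of
`lam · S` under the centred homogeneous Gibbs law `G_N(1, 0, 1)` is `≤ e^B`, then for every drift `u` the Gaussian
linear functional is controlled: `lam (Γ(u) − η C₃(u)) ≤ ‖u‖²/2 + B/(N+1)` with `Γ(u) = E_{N(u,id)}[R(‖v‖²) v₀]`,
`C₃(u) = E_{N(u,id)} ‖v‖³` (Donsker–Varadhan under `G_N(1, u, 1)`, `KL ≤ (N+1)‖u‖²/2`, Fubini + invariance, pathwise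
`S ≥ Σᵢ (q̄ᵢ₀ − η cubᵢ)`). [folklore] -/
theorem drift_pressure_bound {σ : ℝ} (hσ : 0 < σ) (hσ2 : σ ≤ 1 / 2) {N : ℕ}
    (Φ : HardSphereFlow (Torus.geometry (Fin 3)) (hsDiameter σ N) (N + 1))
    {w k K η lam B : ℝ} (hw : 0 < w) (hk : 0 ≤ k) (hK : 0 ≤ K) (hη : 0 ≤ η) (hlam : 0 < lam) (u : V3)
    (hbound : ∫⁻ z, ENNReal.ofReal (Real.exp (lam * ∑ i : Fin (N + 1),
        (if η * (w⁻¹ * ∫ r in (0:ℝ)..w, ‖(Φ.flow r z i).2 - 0‖ ^ 3) <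
            ‖w⁻¹ • ∫ r in (0:ℝ)..w, (if k ^ 2 < ‖(Φ.flow r z i).2 - 0‖ ^ 2 ∧ ‖(Φ.flow r z i).2 - 0‖ ^ 2 ≤ K ^ 2
                then ‖(Φ.flow r z i).2 - 0‖ ^ 2 - k ^ 2 else 0) • ((Φ.flow r z i).2 - 0)‖
          then w⁻¹ * ∫ r in (0:ℝ)..w,
            (if k < ‖(Φ.flow r z i).2 - 0‖ ∧ ‖(Φ.flow r z i).2 - 0‖ ≤ K then ‖(Φ.flow r z i).2 - 0‖ ^ 3 else 0)
          else 0)))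
        ∂(localGibbsLaw σ (fun _ => (1:ℝ)) (fun _ => (0:V3)) (fun _ => (1:ℝ)) N Φ) ≤ ENNReal.ofReal (Real.exp B)) :
    lam * ((∫ v, (if k ^ 2 < ‖v‖ ^ 2 ∧ ‖v‖ ^ 2 ≤ K ^ 2 then ‖v‖ ^ 2 - k ^ 2 else 0) * v 0 ∂gaussMeasure u 1) -
      η * ∫ v, ‖v‖ ^ 3 ∂gaussMeasure u 1) ≤ ‖u‖ ^ 2 / 2 + B / ((N : ℝ) + 1) := by
  -- the two laws: the centred reference `P` and the drifted law `Q`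
  set P := localGibbsLaw σ (fun _ => (1:ℝ)) (fun _ => (0:V3)) (fun _ => (1:ℝ)) N Φ with hPdef
  set Q := localGibbsLaw σ (fun _ => (1:ℝ)) (fun _ => u) (fun _ => (1:ℝ)) N Φ with hQdef
  haveI hPprob : IsProbabilityMeasure P := isProbabilityMeasure_localGibbsLaw (a₀ := fun _ => (1:ℝ))
    (θ₀ := fun _ => (1:ℝ)) (u₀ := fun _ => (0:V3)) continuous_const continuous_const continuous_const
    (fun _ => one_pos) (fun _ => one_pos) hσ2 N Φ
  haveI hQprob : IsProbabilityMeasure Q := isProbabilityMeasure_localGibbsLaw (a₀ := fun _ => (1:ℝ))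
    (θ₀ := fun _ => (1:ℝ)) (u₀ := fun _ => u) continuous_const continuous_const continuous_const
    (fun _ => one_pos) (fun _ => one_pos) hσ2 N Φ
  -- entropy budget `KL(Q ‖ P) ≤ (N+1)‖u‖²/2`
  have hKL : klDiv Q P ≤ ENNReal.ofReal (((N : ℝ) + 1) * (‖u‖ ^ 2 / 2)) :=
    RateFloorDriftEntropy.stub_klDiv_localGibbsLaw_drift_le σ hσ hσ2 (fun _ => u) continuous_const ‖u‖
      (fun _ => le_rfl) N Φ
  have hfin : klDiv Q P ≠ ⊤ := ne_top_of_le_ne_top ENNReal.ofReal_ne_top hKL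
  have hKLr : (klDiv Q P).toReal ≤ ((N : ℝ) + 1) * (‖u‖ ^ 2 / 2) :=
    ENNReal.toReal_le_of_le_ofReal (by positivity) hKL
  -- support and invariance
  have hac : ∀ u' : V3, localGibbsLaw σ (fun _ => (1:ℝ)) (fun _ => u') (fun _ => (1:ℝ)) N Φ ≪
      liouville (Torus.geometry (Fin 3)) (N + 1) (hsDiameter σ N) := fun u' => by
    rw [localGibbsLaw_eq]
    exact localGibbsMeasure_absolutelyContinuous σ _ _ _ N Φ
  have hgoodP : P Φ.goodᶜ = 0 := hac 0 Φ.measure_compl_good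
  have hgoodQ : Q Φ.goodᶜ = 0 := hac u Φ.measure_compl_good
  have haeQ : ∀ᵐ z ∂Q, z ∈ Φ.good := compl_compl Φ.good ▸ (mem_ae_iff.2 (by simpa using hgoodQ))
  have hinvQ : ∀ t, MeasurePreserving (Φ.flow t) Q Q := fun t =>
    measurePreserving_flow_localGibbsLaw_const σ 1 1 u N Φ t
  -- the functionals
  set S : Config (N + 1) (Fin 3) T3 → ℝ := fun z => ∑ i : Fin (N + 1),
        (if η * (w⁻¹ * ∫ r in (0:ℝ)..w, ‖(Φ.flow r z i).2 - 0‖ ^ 3) <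
            ‖w⁻¹ • ∫ r in (0:ℝ)..w, (if k ^ 2 < ‖(Φ.flow r z i).2 - 0‖ ^ 2 ∧ ‖(Φ.flow r z i).2 - 0‖ ^ 2 ≤ K ^ 2
                then ‖(Φ.flow r z i).2 - 0‖ ^ 2 - k ^ 2 else 0) • ((Φ.flow r z i).2 - 0)‖
          then w⁻¹ * ∫ r in (0:ℝ)..w,
            (if k < ‖(Φ.flow r z i).2 - 0‖ ∧ ‖(Φ.flow r z i).2 - 0‖ ≤ K then ‖(Φ.flow r z i).2 - 0‖ ^ 3 else 0)
          else 0) with hSdef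
  set g₁ : Fin (N + 1) → Config (N + 1) (Fin 3) T3 → ℝ := fun i z =>
    (if k ^ 2 < ‖(z i).2 - 0‖ ^ 2 ∧ ‖(z i).2 - 0‖ ^ 2 ≤ K ^ 2 then ‖(z i).2 - 0‖ ^ 2 - k ^ 2 else 0) * ((z i).2 - 0) 0
    with hg₁def
  set g₃ : Fin (N + 1) → Config (N + 1) (Fin 3) T3 → ℝ := fun i z => ‖(z i).2 - 0‖ ^ 3 with hg₃def
  set f : Fin (N + 1) → Config (N + 1) (Fin 3) T3 → ℝ := fun i z =>
    w⁻¹ * (∫ r in (0:ℝ)..w, g₁ i (Φ.flow r z)) - η * (w⁻¹ * ∫ r in (0:ℝ)..w, g₃ i (Φ.flow r z)) with hfdef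
  set T : Config (N + 1) (Fin 3) T3 → ℝ := fun z => ∑ i : Fin (N + 1), f i z with hTdef
  -- Gaussian one-body quantities
  set Γ : ℝ := ∫ v, (if k ^ 2 < ‖v‖ ^ 2 ∧ ‖v‖ ^ 2 ≤ K ^ 2 then ‖v‖ ^ 2 - k ^ 2 else 0) * v 0 ∂gaussMeasure u 1 with hΓdef
  set C₃ : ℝ := ∫ v, ‖v‖ ^ 3 ∂gaussMeasure u 1 with hC₃def
  -- (1) `S ≥ 0`
  have hS0 : ∀ z, 0 ≤ S z := by
    intro z
    refine Finset.sum_nonneg fun i _ => ?_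
    split_ifs
    · exact mul_nonneg (inv_nonneg.2 hw.le)
        (intervalIntegral.integral_nonneg hw.le fun r _ => bandCube_nonneg k K _)
    · exact le_rfl
  -- (2) `S` is a.e.-measurable under `P`
  have hSm : AEMeasurable S P := stub_aemeasurable_bandFunctional Φ hgoodP w k K η 0
  -- (3) pathwise `T ≤ S` on the good set
  have hTS : ∀ z ∈ Φ.good, T z ≤ S z := by
    intro z hz
    refine Finset.sum_le_sum fun i _ => ?_
    have hWm : Measurable fun r : ℝ => (Φ.flow r z i).2 - 0 :=
      ((measurable_pi_apply i).comp (AntiMazurCertificate.measurable_flow_orbit Φ hz)).snd.sub_const _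
    exact linear_le_summand hw hk hK hη hWm
  -- (4) Donsker–Varadhan for `lam • S` under `Q` against `P`
  obtain ⟨hFint, hFle⟩ := integral_le_toReal_klDiv_add_of_nonneg_ae (μ := Q) (ν := P) hfin
    (F := fun z => lam * S z) (hSm.const_mul lam) (ae_of_all _ fun z => mul_nonneg hlam.le (hS0 z)) hbound
  -- (5) the one-body observables under `Q`
  have hφm : ∀ i : Fin (N + 1), Measurable fun z : Config (N + 1) (Fin 3) T3 => (z i).2 := fun i =>
    (measurable_pi_apply i).snd
  have hmapQ : ∀ i : Fin (N + 1), Q.map (fun z => (z i).2) = gaussMeasure u 1 := fun i =>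
    stub_map_vel_localGibbsLaw_const hσ2 one_pos one_pos u N Φ i
  have hRm : Measurable fun v : V3 =>
      (if k ^ 2 < ‖v‖ ^ 2 ∧ ‖v‖ ^ 2 ≤ K ^ 2 then ‖v‖ ^ 2 - k ^ 2 else 0) * v 0 :=
    ((measurable_Rrad k K).comp (measurable_norm.pow_const 2)).mul (EuclideanSpace.proj (𝕜 := ℝ) (0 : Fin 3)).measurable
  have hg₁m : ∀ i, Measurable (g₁ i) := fun i => by
    have h := hRm.comp ((hφm i).sub_const (0 : V3))
    exact h
  have hg₁b : ∀ i z, |g₁ i z| ≤ K ^ 3 := fun i z => abs_Rrad_mul_coord_le hk hK _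
  have hg₃m : ∀ i, Measurable (g₃ i) := fun i => ((hφm i).sub_const (0 : V3)).norm.pow_const 3
  have hg₃0 : ∀ i z, 0 ≤ g₃ i z := fun i z => by positivity
  have hnorm3 : Integrable (fun v : V3 => ‖v‖ ^ 3) (gaussMeasure u 1) := by
    have h := (IsGaussian.memLp_id (gaussMeasure u 1) 3 (by norm_num)).integrable_norm_pow (by norm_num)
    simpa using h
  have hg₁val : ∀ i, ∫ z, g₁ i z ∂Q = Γ := by
    intro i
    have h := integral_map (μ := Q) (hφm i).aemeasurable (f := fun v : V3 =>
      (if k ^ 2 < ‖v - 0‖ ^ 2 ∧ ‖v - 0‖ ^ 2 ≤ K ^ 2 then ‖v - 0‖ ^ 2 - k ^ 2 else 0) * (v - 0) 0)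
      (by simp only [sub_zero]; exact hRm.aestronglyMeasurable)
    rw [hmapQ i] at h
    simp only [hg₁def, hΓdef, sub_zero] at h ⊢
    rw [← h]
  have hg₃i : ∀ i, Integrable (g₃ i) Q := by
    intro i
    have h : Integrable (fun v : V3 => ‖v - 0‖ ^ 3) (Q.map fun z => (z i).2) := by
      rw [hmapQ i]; simpa only [sub_zero] using hnorm3
    exact (integrable_map_measure h.aestronglyMeasurable (hφm i).aemeasurable).1 h
  have hg₃val : ∀ i, ∫ z, g₃ i z ∂Q = C₃ := by
    intro i
    have h := integral_map (μ := Q) (hφm i).aemeasurable (f := fun v : V3 => ‖v - 0‖ ^ 3)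
      (by simp only [sub_zero]; exact (measurable_norm.pow_const 3).aestronglyMeasurable)
    rw [hmapQ i] at h
    simp only [hg₃def, hC₃def, sub_zero] at h ⊢
    rw [← h]
  -- (6) Fubini + invariance
  have hW1 : ∀ i, Integrable (fun z => ∫ r in (0:ℝ)..w, g₁ i (Φ.flow r z)) Q ∧
      ∫ z, (∫ r in (0:ℝ)..w, g₁ i (Φ.flow r z)) ∂Q = (w - 0) * ∫ z, g₁ i z ∂Q := fun i =>
    stub_integral_intervalIntegral_comp_flow Φ Q hinvQ hgoodQ (hg₁m i) (hg₁b i) hw.le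
  have hW2 : ∀ i, Integrable (fun z => ∫ r in (0:ℝ)..w, g₃ i (Φ.flow r z)) Q ∧
      ∫ z, (∫ r in (0:ℝ)..w, g₃ i (Φ.flow r z)) ∂Q ≤ (w - 0) * ∫ z, g₃ i z ∂Q := fun i =>
    stub_integral_intervalIntegral_comp_flow_of_nonneg Φ Q hinvQ hgoodQ (hg₃m i) (hg₃0 i) (hg₃i i) hw.le
  have hfint : ∀ i, Integrable (f i) Q := fun i =>
    ((hW1 i).1.const_mul w⁻¹).sub' (((hW2 i).1.const_mul w⁻¹).const_mul η)
  have hTint : Integrable T Q := integrable_finsetSum _ fun i _ => hfint i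
  have hfval : ∀ i, Γ - η * C₃ ≤ ∫ z, f i z ∂Q := by
    intro i
    have h3 : w⁻¹ * ∫ z, (∫ r in (0:ℝ)..w, g₃ i (Φ.flow r z)) ∂Q ≤ C₃ := by
      calc w⁻¹ * ∫ z, (∫ r in (0:ℝ)..w, g₃ i (Φ.flow r z)) ∂Q ≤ w⁻¹ * ((w - 0) * ∫ z, g₃ i z ∂Q) :=
            mul_le_mul_of_nonneg_left (hW2 i).2 (inv_nonneg.2 hw.le)
        _ = C₃ := by rw [hg₃val i, sub_zero, ← mul_assoc, inv_mul_cancel₀ hw.ne', one_mul]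
    have h1 : w⁻¹ * ∫ z, (∫ r in (0:ℝ)..w, g₁ i (Φ.flow r z)) ∂Q = Γ := by
      rw [(hW1 i).2, hg₁val i, sub_zero, ← mul_assoc, inv_mul_cancel₀ hw.ne', one_mul]
    have hv : ∫ z, f i z ∂Q = w⁻¹ * ∫ z, (∫ r in (0:ℝ)..w, g₁ i (Φ.flow r z)) ∂Q -
        η * (w⁻¹ * ∫ z, (∫ r in (0:ℝ)..w, g₃ i (Φ.flow r z)) ∂Q) := by
      simp only [hfdef]
      rw [integral_sub ((hW1 i).1.const_mul w⁻¹) (((hW2 i).1.const_mul w⁻¹).const_mul η), integral_const_mul,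
        integral_const_mul, integral_const_mul]
    rw [hv, h1]
    linarith [mul_le_mul_of_nonneg_left h3 hη]
  have hTval : ((N : ℝ) + 1) * (Γ - η * C₃) ≤ ∫ z, T z ∂Q := by
    have hsum : ∫ z, T z ∂Q = ∑ i : Fin (N + 1), ∫ z, f i z ∂Q := by
      simp only [hTdef]
      exact integral_finsetSum _ fun i _ => hfint i
    rw [hsum]
    calc ((N : ℝ) + 1) * (Γ - η * C₃) = ∑ _i : Fin (N + 1), (Γ - η * C₃) := by
          rw [Finset.sum_const, Finset.card_univ, Fintype.card_fin, nsmul_eq_mul]; push_cast; ring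
      _ ≤ _ := Finset.sum_le_sum fun i _ => hfval i
  -- (7) assemble
  have hmono : ∫ z, lam * T z ∂Q ≤ ∫ z, lam * S z ∂Q :=
    integral_mono_ae (hTint.const_mul lam) hFint (haeQ.mono fun z hz => mul_le_mul_of_nonneg_left (hTS z hz) hlam.le)
  have hchain : lam * (((N : ℝ) + 1) * (Γ - η * C₃)) ≤ ((N : ℝ) + 1) * (‖u‖ ^ 2 / 2) + B := by
    calc lam * (((N : ℝ) + 1) * (Γ - η * C₃)) ≤ lam * ∫ z, T z ∂Q := mul_le_mul_of_nonneg_left hTval hlam.le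
      _ = ∫ z, lam * T z ∂Q := (integral_const_mul lam T).symm
      _ ≤ ∫ z, lam * S z ∂Q := hmono
      _ ≤ (klDiv Q P).toReal + B := hFle
      _ ≤ ((N : ℝ) + 1) * (‖u‖ ^ 2 / 2) + B := by linarith
  have hN1 : (0 : ℝ) < (N : ℝ) + 1 := by positivity
  rw [show ‖u‖ ^ 2 / 2 + B / ((N : ℝ) + 1) = (((N : ℝ) + 1) * (‖u‖ ^ 2 / 2) + B) / ((N : ℝ) + 1) by
    field_simp]
  rw [le_div_iff₀ hN1]
  linarith [hchain]

/-! ## §4 The refutation -/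

/-- **Refutation of the crux `BandCoherenceLDAlongFamilies`** (stmt-AtomisticToContinuum-17700) by the Galilean-drift
witness.  Instance: `t₁ = 0`, `Θ̄ = 1`, constant family `a = θ = 1`, `u = 0`, `σ = min (1/4) η₀`, any flows (Alexander),
`K₁ = K := M + 2` with `M = E(1 + ‖ξ‖)⁶` the sixth Gaussian moment constant, `K⋆ = k = D := 1/(2K)`,
`R(s′) = (s′ − k²)1{k² < s′ ≤ K²}`, `η = 8Km/(1 + M)`, `ε = m := 1/(64K²)`.  For the `τ₀, N₀` produced by the statement,
(★) with the drift `u = D e₀` (`KL ≤ (N+1)D²/2`) and the Gaussian bounds `Γ ≥ 5D − k²D − k³ − M/K³`, `C₃ ≤ 1 + M`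
(`BandCoherenceLDNegative.gamma_lower`, `…integral_norm_pow_three_gaussD_le`) give `19/(64K²) − (1/4 + M)/(8K⁴) ≤ 9/(64K²)`,
i.e. `5K²/4 ≤ M + 1/4`, contradicting `K = M + 2`.  Class `refuted-misstated`: the witness exploits the FIXED tilt
`(8Θ̄K₁)⁻¹` against a functional with non-zero linear response to a Galilean boost (quadratic entropy cost); the planners'
repair is the signed, Mazur-shifted band current at class-uniform tilt (crux workfiles IdeatorTwoBoostWitnessAndRepair.md,
IdeatorOneNotes-r1.md). [folklore] -/
theorem not_BandCoherenceLDAlongFamilies :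
    ¬ Summit.AtomisticToContinuum.HydrodynamicLimit.Theses.OneFlightGossipEngine.BandCoherenceLDAlongFamilies := by
  intro h
  obtain ⟨η₀, hη₀, h⟩ := h
  -- reduced diameter: packing guard `σ³ ≤ η₀` and `σ ≤ 1/4`
  set σ : ℝ := min (1 / 4) η₀ with hσdef
  have hσpos : 0 < σ := lt_min (by norm_num) hη₀
  have hσ4 : σ ≤ 1 / 4 := min_le_left _ _
  have hση : σ ≤ η₀ := min_le_right _ _
  have hσ2 : σ ≤ 1 / 2 := hσ4.trans (by norm_num)
  have hσlt : σ < 2⁻¹ := hσ4.trans_lt (by norm_num)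
  -- flows exist (Alexander's theorem on the torus)
  have hΦex : ∀ N : ℕ, Nonempty (HardSphereFlow (Torus.geometry (Fin 3)) (hsDiameter σ N) (N + 1)) := fun N =>
    HardSphereFlow.nonempty_torus_holds (hsDiameter_pos hσpos N) ((hsDiameter_le hσpos.le N).trans_lt hσlt) (N + 1)
  set Φ : (N : ℕ) → HardSphereFlow (Torus.geometry (Fin 3)) (hsDiameter σ N) (N + 1) := fun N => (hΦex N).some
    with hΦdef
  have hguard : ∀ s ∈ Set.Icc (0 : ℝ) 0, σ ^ 3 * (⨆ _x : T3, (1 : ℝ)) ≤ η₀ * ∫ _x : T3, (1 : ℝ) := by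
    intro s _
    haveI : IsProbabilityMeasure (volume : Measure T3) := by
      rw [volume_pi]; infer_instance
    rw [ciSup_const, integral_const, smul_eq_mul, probReal_univ]
    have h3 : σ ^ 3 ≤ σ ^ 1 := pow_le_pow_of_le_one hσpos.le (hσ4.trans (by norm_num)) (by norm_num)
    rw [pow_one] at h3
    nlinarith
  -- the constants of the witness
  set M : ℝ := ∫ w, (1 + ‖w‖) ^ 6 ∂stdGaussian V3 with hMdef
  have hM0 : 0 ≤ M := Msix_nonneg
  set K : ℝ := M + 2 with hKdef
  have hK2 : 2 ≤ K := by rw [hKdef]; linarith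
  have hKpos : 0 < K := by linarith
  set D : ℝ := 2⁻¹ * K⁻¹ with hDdef
  have hDpos : 0 < D := by positivity
  have hDK : D * K = 2⁻¹ := by rw [hDdef, mul_assoc, inv_mul_cancel₀ hKpos.ne', mul_one]
  have hD4 : D ≤ 1 / 4 := by
    have : D * 2 ≤ D * K := mul_le_mul_of_nonneg_left hK2 hDpos.le
    linarith
  have hD1 : D ≤ 1 := hD4.trans (by norm_num)
  have hDleK : D ≤ K := hD1.trans ((by norm_num : (1 : ℝ) ≤ 2).trans hK2)
  set m : ℝ := (64 * K ^ 2)⁻¹ with hmdef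
  have hm : 0 < m := by positivity
  have hmK : m * (64 * K ^ 2) = 1 := inv_mul_cancel₀ (by positivity)
  set η : ℝ := 8 * K * m / (1 + M) with hηdef
  have hη : 0 < η := by positivity
  have hηM : η * (1 + M) = 8 * K * m := div_mul_cancel₀ _ (by positivity)
  -- the witness weight
  have hR : Measurable (fun p : ℝ × T3 × ℝ => (fun (_ : ℝ) (_ : T3) (s' : ℝ) =>
      (if D ^ 2 < s' ∧ s' ≤ K ^ 2 then s' - D ^ 2 else 0)) p.1 p.2.1 p.2.2) :=
    (measurable_Rrad D K).comp (measurable_snd.comp measurable_snd)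
  -- instantiate the crux
  obtain ⟨τ₀, hτ₀, hτ⟩ := h 0 1 (fun _ _ => 1) (fun _ _ => 1) (fun _ _ => 0) continuous_const continuous_const
    continuous_const (fun _ _ => one_pos) (fun _ _ => one_pos) (fun _ _ _ => le_rfl) σ hσpos hguard Φ D K hDpos
    hDleK (fun _ _ s' => if D ^ 2 < s' ∧ s' ≤ K ^ 2 then s' - D ^ 2 else 0) hR
    (fun _ _ s' hs' => Rrad_eq_zero_of_le hs') (fun _ _ s' => abs_Rrad_le _ _ s') η hη m hm
  obtain ⟨N₀, hN⟩ := hτ τ₀ le_rfl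
  have key := hN N₀ le_rfl 0 (Set.left_mem_Icc.2 le_rfl)
  clear hN hτ h
  dsimp only at key
  set w : ℝ := τ₀ * ((N₀ : ℝ) + 1) ^ (-(1 / 3 : ℝ)) with hwdef
  have hw : 0 < w := mul_pos hτ₀ (Real.rpow_pos_of_pos (by positivity) _)
  have hN1 : ((N₀ : ℝ) + 1) ≠ 0 := by positivity
  -- (★) with the drift `D e₀`
  have star := drift_pressure_bound hσpos hσ2 (Φ N₀) hw hDpos.le hKpos.le hη.le (by positivity)
    (D • (EuclideanSpace.single (0 : Fin 3) (1 : ℝ) : V3)) key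
  rw [norm_smul_e0_sq, mul_div_cancel_right₀ m hN1] at star
  -- the Gaussian bounds
  have hΓ := gamma_lower (D := D) (k := D) (K := K) hDpos.le hDpos.le hDleK hKpos
  have hM6 := integral_norm_pow_six_gaussD_le hDpos.le hD1
  have hC₃ := integral_norm_pow_three_gaussD_le hDpos.le hD1
  set Γ : ℝ := ∫ v, (if D ^ 2 < ‖v‖ ^ 2 ∧ ‖v‖ ^ 2 ≤ K ^ 2 then ‖v‖ ^ 2 - D ^ 2 else 0) * v 0
    ∂gaussMeasure (D • (EuclideanSpace.single (0 : Fin 3) (1 : ℝ) : V3)) 1 with hΓdef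
  set C₃ : ℝ := ∫ v, ‖v‖ ^ 3 ∂gaussMeasure (D • (EuclideanSpace.single (0 : Fin 3) (1 : ℝ) : V3)) 1 with hC₃def
  set M₆ : ℝ := ∫ v, ‖v‖ ^ 6 ∂gaussMeasure (D • (EuclideanSpace.single (0 : Fin 3) (1 : ℝ) : V3)) 1 with hM₆def
  -- arithmetic
  have hlam : (0 : ℝ) < (8 * 1 * K)⁻¹ := by positivity
  have hM6K : M₆ / K ^ 3 ≤ M / K ^ 3 := div_le_div_of_nonneg_right hM6 (by positivity)
  have hηC : η * C₃ ≤ 8 * K * m := by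
    calc η * C₃ ≤ η * (1 + M) := mul_le_mul_of_nonneg_left hC₃ hη.le
      _ = 8 * K * m := hηM
  have hlow : (8 * 1 * K)⁻¹ * (5 * D - D ^ 2 * D - D ^ 3 - M / K ^ 3 - 8 * K * m) ≤ D ^ 2 / 2 + m := by
    refine le_trans (mul_le_mul_of_nonneg_left ?_ hlam.le) star
    linarith
  -- clear denominators
  have h1 : 5 * D - D ^ 2 * D - D ^ 3 - M / K ^ 3 - 8 * K * m ≤ (D ^ 2 / 2 + m) * (8 * K) := by
    have h := mul_le_mul_of_nonneg_right hlow (by positivity : (0 : ℝ) ≤ 8 * K)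
    have e : (8 * 1 * K)⁻¹ * (5 * D - D ^ 2 * D - D ^ 3 - M / K ^ 3 - 8 * K * m) * (8 * K) =
        5 * D - D ^ 2 * D - D ^ 3 - M / K ^ 3 - 8 * K * m := by
      field_simp
    linarith
  have hKD2 : K * D ^ 2 = D / 2 := by
    rw [hDdef]; field_simp
  have hKm : K * m = D / 32 := by
    rw [hmdef, hDdef]; field_simp; norm_num
  have h2 : 5 / 2 * D - 2 * D ^ 3 ≤ M / K ^ 3 := by linarith only [h1, hKD2, hKm]
  have h3 : (5 / 2 * D - 2 * D ^ 3) * K ^ 3 ≤ M := by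
    have h := mul_le_mul_of_nonneg_right h2 (pow_nonneg hKpos.le 3)
    rwa [div_mul_cancel₀ _ (by positivity : K ^ 3 ≠ 0)] at h
  have h4 : (5 / 2 * D - 2 * D ^ 3) * K ^ 3 = 5 / 2 * (D * K) * K ^ 2 - 2 * (D * K) ^ 3 := by ring
  rw [h4, hDK] at h3
  have h5 : K * 2 ≤ K * K := mul_le_mul_of_nonneg_left hK2 hKpos.le
  have hMK : M = K - 2 := by linarith [hKdef]
  norm_num at h3
  linarith only [h3, h5, hMK, hKpos]

end BandCoherenceLDRefutation

end Summit.AtomisticToContinuum.HydrodynamicLimit.Theorems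

end
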